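import Mathlib
import Summits.Ventures.PercRepro2.HMFOEdgeNormChord

/-!
# The normalised chord across `{a₃, o}` carries (HCOV) as well: the `o`-edge is deletable for the
covariance form modulo the same two X-free rows (blind cell PercRepro2, night-1 g18;
NIGHT1-G18.md §1)

`Gc = HMFc + 2 Z D (X̂ − Xexact)` (`Gc_eq_HMFc_add`, from `CovForm.two_Z_eq`), and along an edge
`f = {a₃, o}` both `X̂` and `Xexact` are `(1 − q)` times their value without the edge
(`XhatPin.Xhat_eq_pin` resp. `Xexact_eq_pin_o`: every one of the six probabilities of `Xexact`
vanishes at the coincidence `a₃ = o`).  So the difference `Gc − HMFc = 2 Z D (1 − q) (X̂⁰ − Xexact⁰)`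
is exactly what the normalised chord `Z⁰ D⁰ · Φ_o(p) ≥ Z D · HMFc(p⁰)` needs to become the chord of
`Gc / (Z D)`:

* **`HCov_of_o_edge_of_normChord`**: the chord condition (the SAME hypothesis as for (HMF)) and
  (HCOV) without the edge give (HCOV);
* **`HCov_of_o_edge_of_tangents`**: `0 ≤ τ₀ → 0 ≤ τ₁ → HCov (p[f ↦ 0]) → HCov p`.

Own code; standard axioms.
-/

namespace Summit.Ventures.PercRepro2

open UnionCluster CovForm

namespace OEdge

section HCovChord

variable {V : Type*} {E : Type*} [Fintype E] [DecidableEq E] [Fintype V] [DecidableEq V]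
  {R : Type*} [Field R] [LinearOrder R] [IsStrictOrderedRing R]

variable (p : E → R) (ends : E → Sym2 V) (o a₁ a₂ a₃ b : V) {f : E}

/-- `Gc = HMFc + 2 Z D (X̂ − Xexact)` (the cleared identity `two_Z_eq` against the definition of
`HMFc`). -/
lemma Gc_eq_HMFc_add :
    Gc p ends o a₁ a₂ a₃ b =
      HMFc p ends o a₁ a₂ a₃ b +
        2 * prob p (avoidAll ends a₂ {a₁}) * prob p (PDEvent ends a₁ a₂ a₃) *
          (Xhat p ends o a₁ a₂ a₃ b - Xexact p ends o a₁ a₂ a₃ b) := by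
  have h := CovForm.two_Z_eq p ends o a₁ a₂ a₃ b
  unfold HMFc Xexact
  linear_combination -h

omit [Fintype V] [DecidableEq V] [LinearOrder R] [IsStrictOrderedRing R] in
/-- With `f = {a₃, o}` pinned open, `P(PD, o ∈ C₁, b ∈ C₂) = 0`. -/
lemma prob_PD_oL_bH_update_one (hf : ends f = s(a₃, o)) :
    prob (Function.update p f 1)
      (PDEvent ends a₁ a₂ a₃ ∩ connEvent ends a₁ o ∩ connEvent ends a₂ b) = 0 := by
  rw [Set.inter_assoc, SureEdge.prob_PD (Function.update p f 1) (by simp) hf a₁ a₂,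
    ← Set.inter_assoc, Coinc.PD_o_inter_oL, Set.empty_inter, prob_empty]

omit [Fintype V] [DecidableEq V] [LinearOrder R] [IsStrictOrderedRing R] in
/-- With `f = {a₃, o}` pinned open, `P(PD, o ∈ C₂, b ∈ C₁) = 0`. -/
lemma prob_PD_oH_bL_update_one (hf : ends f = s(a₃, o)) :
    prob (Function.update p f 1)
      (PDEvent ends a₁ a₂ a₃ ∩ connEvent ends a₂ o ∩ connEvent ends a₁ b) = 0 := by
  rw [Set.inter_assoc, SureEdge.prob_PD (Function.update p f 1) (by simp) hf a₁ a₂,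
    ← Set.inter_assoc, Coinc.PD_o_inter_oH, Set.empty_inter, prob_empty]

omit [Fintype V] [DecidableEq V] [LinearOrder R] [IsStrictOrderedRing R] in
/-- With `f = {a₃, o}` pinned open, `P(T, o ∈ C₁, Z) = 0` for every `Z`. -/
lemma prob_T_oL_update_one (hf : ends f = s(a₃, o)) (Z : Set (Config E)) :
    prob (Function.update p f 1) (TEvent ends a₁ a₂ a₃ ∩ connEvent ends a₁ o ∩ Z) = 0 := by
  rw [Set.inter_assoc, SureEdge.prob_T (Function.update p f 1) (by simp) hf a₁ a₂,
    ← Set.inter_assoc, (Coinc.T_o_inter ends o a₁ a₂).1, Set.empty_inter, prob_empty]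

omit [Fintype V] [DecidableEq V] [LinearOrder R] [IsStrictOrderedRing R] in
/-- With `f = {a₃, o}` pinned open, `P(T′, o ∈ C₂, Z) = 0` for every `Z`. -/
lemma prob_T'_oH_update_one (hf : ends f = s(a₃, o)) (Z : Set (Config E)) :
    prob (Function.update p f 1) (TEvent ends a₂ a₁ a₃ ∩ connEvent ends a₂ o ∩ Z) = 0 := by
  rw [Set.inter_assoc, SureEdge.prob_T (Function.update p f 1) (by simp) hf a₂ a₁,
    ← Set.inter_assoc, (Coinc.T'_o_inter ends o a₁ a₂).1, Set.empty_inter, prob_empty]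

omit [Fintype V] [DecidableEq V] [LinearOrder R] [IsStrictOrderedRing R] in
/-- Along `f = {a₃, o}` the exact `X` is `(1 − q)` times its value without the edge. -/
lemma Xexact_eq_pin_o (hf : ends f = s(a₃, o)) :
    Xexact p ends o a₁ a₂ a₃ b =
      (1 - p f) * Xexact (Function.update p f 0) ends o a₁ a₂ a₃ b := by
  unfold Xexact deltaL deltaH
  rw [prob_eq_of_update_one_eq_zero p _ (prob_PD_oL_bH_update_one p ends o a₁ a₂ a₃ b hf),
    prob_eq_of_update_one_eq_zero p _ (prob_PD_oH_bL_update_one p ends o a₁ a₂ a₃ b hf),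
    prob_eq_of_update_one_eq_zero p _ (prob_T_oL_update_one p ends o a₁ a₂ a₃ hf _),
    prob_eq_of_update_one_eq_zero p _ (prob_T_oL_update_one p ends o a₁ a₂ a₃ hf _),
    prob_eq_of_update_one_eq_zero p _ (prob_T'_oH_update_one p ends o a₁ a₂ a₃ hf _),
    prob_eq_of_update_one_eq_zero p _ (prob_T'_oH_update_one p ends o a₁ a₂ a₃ hf _)]
  ring

omit [LinearOrder R] [IsStrictOrderedRing R] in
/-- Along `f = {a₃, o}` the mean field is `(1 − q)` times its value without the edge. -/
lemma Xhat_eq_pin_o (hf : ends f = s(a₃, o)) :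
    Xhat p ends o a₁ a₂ a₃ b = (1 - p f) * Xhat (Function.update p f 0) ends o a₁ a₂ a₃ b := by
  rw [XhatPin.Xhat_eq_pin p ends o a₁ a₂ a₃ b (by rw [hf]; exact Sym2.mem_mk_left a₃ o),
    Xhat_update_one p ends o b hf]
  ring

/-- **The covariance form across `{a₃, o}`**: `Gc = (1 − q) · (Φ_o + 2 Z D (X̂⁰ − Xexact⁰))`. -/
lemma Gc_eq_factor_o (hf : ends f = s(a₃, o)) :
    Gc p ends o a₁ a₂ a₃ b =
      (1 - p f) * (PhiO p ends o a₁ a₂ a₃ b f +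
        2 * prob p (avoidAll ends a₂ {a₁}) * prob p (PDEvent ends a₁ a₂ a₃) *
          (Xhat (Function.update p f 0) ends o a₁ a₂ a₃ b -
            Xexact (Function.update p f 0) ends o a₁ a₂ a₃ b)) := by
  rw [Gc_eq_HMFc_add, HMFc_eq_factor_o p ends o b hf, Xexact_eq_pin_o p ends o a₁ a₂ a₃ b hf,
    Xhat_eq_pin_o p ends o a₁ a₂ a₃ b hf]
  ring

/-- **(HCOV) across the edge `{a₃, o}` from the normalised chord**: the chord condition
`Z D · HMFc(p⁰) ≤ Z⁰ D⁰ · Φ_o(p)` (the same hypothesis as for (HMF)) and (HCOV) without the edge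
give (HCOV). -/
theorem HCov_of_o_edge_of_normChord (hp : IsProbVec p) (hf : ends f = s(a₃, o))
    (hchord : prob p (avoidAll ends a₂ {a₁}) * prob p (PDEvent ends a₁ a₂ a₃) *
        HMFc (Function.update p f 0) ends o a₁ a₂ a₃ b ≤
      prob (Function.update p f 0) (avoidAll ends a₂ {a₁}) *
        prob (Function.update p f 0) (PDEvent ends a₁ a₂ a₃) * PhiO p ends o a₁ a₂ a₃ b f)
    (h0 : HCov (Function.update p f 0) ends o a₁ a₂ a₃ b) : HCov p ends o a₁ a₂ a₃ b := by
  have hp0 : IsProbVec (Function.update p f 0) := hp.update f le_rfl zero_le_one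
  have hN0 : 0 ≤ prob (Function.update p f 0) (avoidAll ends a₂ {a₁}) *
      prob (Function.update p f 0) (PDEvent ends a₁ a₂ a₃) :=
    mul_nonneg (prob_nonneg hp0 _) (prob_nonneg hp0 _)
  have hN : 0 ≤ prob p (avoidAll ends a₂ {a₁}) * prob p (PDEvent ends a₁ a₂ a₃) :=
    mul_nonneg (prob_nonneg hp _) (prob_nonneg hp _)
  have hΔ : 0 ≤ Xhat (Function.update p f 0) ends o a₁ a₂ a₃ b -
      Xexact (Function.update p f 0) ends o a₁ a₂ a₃ b := by
    linarith [Xexact_le_Xhat (Function.update p f 0) hp0 ends o a₁ a₂ a₃ b]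
  unfold HCov at h0 ⊢
  rw [Gc_eq_HMFc_add] at h0
  rw [Gc_eq_factor_o p ends o a₁ a₂ a₃ b hf]
  rcases hN0.lt_or_eq with hN0 | hN0
  · -- `N⁰ (Φ_o + 2 N Δ⁰) ≥ N (HMFc⁰ + 2 N⁰ Δ⁰) ≥ 0`
    have h1 : 0 ≤ prob (Function.update p f 0) (avoidAll ends a₂ {a₁}) *
        prob (Function.update p f 0) (PDEvent ends a₁ a₂ a₃) *
        (PhiO p ends o a₁ a₂ a₃ b f +
          2 * prob p (avoidAll ends a₂ {a₁}) * prob p (PDEvent ends a₁ a₂ a₃) *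
            (Xhat (Function.update p f 0) ends o a₁ a₂ a₃ b -
              Xexact (Function.update p f 0) ends o a₁ a₂ a₃ b)) := by
      have h2 := mul_nonneg hN h0
      have h3 := mul_nonneg (mul_nonneg hN hN0.le) hΔ
      nlinarith [hchord, h2, h3]
    exact mul_nonneg (by linarith [hp.le_one f]) ((mul_nonneg_iff_of_pos_left hN0).1 h1)
  · -- the degenerate case: `Z D = 0` and `Gc = 0`
    have hZ0 : prob p (avoidAll ends a₂ {a₁}) ≤
        prob (Function.update p f 0) (avoidAll ends a₂ {a₁}) :=
      EdmRow.prob_le_prob_update_zero_of_isLowerSet hp (EdmRow.isLowerSet_avoidAll ends a₁ a₂) f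
    have hD0 : prob p (PDEvent ends a₁ a₂ a₃) ≤
        prob (Function.update p f 0) (PDEvent ends a₁ a₂ a₃) :=
      EdmRow.prob_le_prob_update_zero_of_isLowerSet hp (EdmRow.isLowerSet_PDEvent ends a₁ a₂ a₃) f
    have hN' : prob p (PDEvent ends a₁ a₂ a₃) * prob p (avoidAll ends a₂ {a₁}) = 0 := by
      rcases mul_eq_zero.1 hN0.symm with hQ | hD
      · exact mul_eq_zero_of_right _ (le_antisymm (hQ ▸ hZ0) (prob_nonneg hp _))
      · exact mul_eq_zero_of_left (le_antisymm (hD ▸ hD0) (prob_nonneg hp _)) _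
    have hG := Chord.Gc_eq_zero_of_degenerate hp ends o a₁ a₂ a₃ b hN'
    rw [Gc_eq_factor_o p ends o a₁ a₂ a₃ b hf] at hG
    rw [hG]

/-- **The `o`-edge is deletable for (HCOV) modulo the two tangent rows**:
`0 ≤ τ₀ → 0 ≤ τ₁ → HCov (p[f ↦ 0]) → HCov p` for `f = {a₃, o}`. -/
theorem HCov_of_o_edge_of_tangents (hp : IsProbVec p) (hf : ends f = s(a₃, o))
    (h0 : 0 ≤ tangentZero p ends o a₁ a₂ a₃ b f) (h1 : 0 ≤ tangentOne p ends o a₁ a₂ a₃ b f)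
    (hHCov : HCov (Function.update p f 0) ends o a₁ a₂ a₃ b) : HCov p ends o a₁ a₂ a₃ b :=
  HCov_of_o_edge_of_normChord p ends o a₁ a₂ a₃ b hp hf
    (normChord_of_tangents p ends o a₁ a₂ a₃ b f hp h0 h1) hHCov

end HCovChord

end OEdge

end Summit.Ventures.PercRepro2
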